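import Mathlib

/-!
# T5Orientation — the orientation sign of the pairing in (N) (support for N0 / N1)

(N) (TIER4 A3 Cor. A5.7 / B3 B7(c); PLAN.md §7(a)) is the non-vanishing of `∫_S ω_{ab} ∧ \overline{ω_{cd}}`
on the compact Picard surface `S` (complex dimension 2), with `ω_{ab}`, `ω_{cd}` the `(2,0)`-forms
`f_{111}^*e_{111} ∧ f_{100}^*e_{100}`, `f_{101}^*e_{101} ∧ f_{110}^*e_{110}` (T4-B4: at the base point
`τ₁` the vertex forms of the types containing `τ₁` are `(1,0)` — B3(d)/Prop. B4.3 — so each wedge of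
two of them is `(2,0)`, and its conjugate `(0,2)`).  The ORIENTATION SIGN of this pairing is the
elementary fact that, with the complex orientation of `S`, `ω ∧ ω̄` is a POSITIVE multiple of the
volume form for every `(2,0)`-form `ω = f dz₁ ∧ dz₂`:

  `dz₁ ∧ dz₂ ∧ dz̄₁ ∧ dz̄₂ = 4 · dx₁ ∧ dy₁ ∧ dx₂ ∧ dy₂`,   hence   `ω ∧ ω̄ = 4 |f|² dx₁ ∧ dy₁ ∧ dx₂ ∧ dy₂`.

The coefficient of the top form after the substitution `dz_j = dx_j + i dy_j`, `dz̄_j = dx_j − i dy_j`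
is the determinant of the coefficient matrix (rows = `dz₁, dz₂, dz̄₁, dz̄₂`, columns =
`dx₁, dy₁, dx₂, dy₂`) — a standard fact about the top exterior power; this file kernel-checks the
determinants: `det_complexCoordinates_four = 4` (and the one-variable `det_complexCoordinates_two
= −2i`: `dz ∧ dz̄ = −2i dx ∧ dy`), the positivity `4 |f|² > 0` for `f ≠ 0`, and the Hodge–Riemann
sign `i^{p−q} (−1)^{k(k−1)/2} = +1` for `(p, q) = (2, 0)`, `k = 2`, which says the same thing.
Consequence for (N): `⟨ω, ω′⟩ := ∫_S ω ∧ \overline{ω′}` is a positive-definite hermitian form on the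
`(2,0)`-forms of `S`, so (N) is the non-orthogonality of `ω_{ab}` and `ω_{cd}` for it — in
particular (N) holds trivially when `ω_{ab} = ω_{cd} ≠ 0`, and the sign/orientation convention
of `S` can only multiply the pairing by a non-zero constant (`±1`).

Nothing about the surface, its forms or the integral is formalised.
-/

namespace Summit.Ventures.HodgeRepro2

open Complex Matrix

/-- The coefficient matrix of `(dz, dz̄)` in `(dx, dy)`: `dz = dx + i dy`, `dz̄ = dx − i dy`. -/
def complexCoordinatesTwo : Matrix (Fin 2) (Fin 2) ℂ := !![1, I; 1, -I]

/-- `dz ∧ dz̄ = −2i · dx ∧ dy`. -/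
theorem det_complexCoordinates_two : complexCoordinatesTwo.det = -2 * I := by
  rw [complexCoordinatesTwo, det_fin_two_of]
  ring

/-- The coefficient matrix of `(dz₁, dz₂, dz̄₁, dz̄₂)` in `(dx₁, dy₁, dx₂, dy₂)`. -/
def complexCoordinatesFour : Matrix (Fin 4) (Fin 4) ℂ :=
  !![1, I, 0, 0; 0, 0, 1, I; 1, -I, 0, 0; 0, 0, 1, -I]

/-- THE ORIENTATION CONSTANT: `dz₁ ∧ dz₂ ∧ dz̄₁ ∧ dz̄₂ = 4 · dx₁ ∧ dy₁ ∧ dx₂ ∧ dy₂`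
(positive, for the complex orientation `dx₁ ∧ dy₁ ∧ dx₂ ∧ dy₂` of a complex surface). -/
theorem det_complexCoordinates_four : complexCoordinatesFour.det = 4 := by
  rw [complexCoordinatesFour]
  simp [Matrix.det_succ_row_zero, Fin.sum_univ_succ, Fin.succAbove]
  ring_nf
  simp [I_sq]
  norm_num

/-- `ω ∧ ω̄ = (f · f̄ · 4) · vol` for `ω = f dz₁ ∧ dz₂`: the coefficient is `4 |f|²`. -/
theorem coeff_wedge_conj (f : ℂ) : f * starRingEnd ℂ f * complexCoordinatesFour.det = 4 * normSq f := by
  rw [det_complexCoordinates_four, mul_conj, mul_comm]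

/-- The coefficient `4 |f|²` is non-negative, and positive iff `f ≠ 0`: `∫_S ω ∧ ω̄ > 0` for every
non-zero `(2,0)`-form — the pairing of (N) is positive definite. -/
theorem coeff_wedge_conj_pos {f : ℂ} (hf : f ≠ 0) :
    0 < (f * starRingEnd ℂ f * complexCoordinatesFour.det).re := by
  rw [coeff_wedge_conj]
  norm_cast
  have := normSq_pos.2 hf
  linarith

/-- The Hodge–Riemann sign `i^{p−q} (−1)^{k(k−1)/2}` for `(p, q) = (2, 0)`, `k = p + q = 2`, is `+1`
— the same statement as `det_complexCoordinates_four > 0`. -/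
theorem hodgeRiemann_sign_two_zero : I ^ (2 - 0) * (-1 : ℂ) ^ (2 * (2 - 1) / 2) = 1 := by
  norm_num [I_sq]

/-- For comparison, the sign for `(p, q) = (1, 0)` on a curve is `i · (−1)^0 = i`, matching
`dz ∧ dz̄ = −2i dx ∧ dy` (so `i · dz ∧ dz̄ = 2 dx ∧ dy > 0`). -/
theorem hodgeRiemann_sign_one_zero : I ^ (1 - 0) * (-1 : ℂ) ^ (1 * (1 - 1) / 2) = I := by
  norm_num

/-- `i · det(dz, dz̄) = 2 > 0`: the one-variable positivity. -/
theorem I_mul_det_complexCoordinates_two : I * complexCoordinatesTwo.det = 2 := by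
  rw [det_complexCoordinates_two]
  ring_nf
  simp [I_sq]

end Summit.Ventures.HodgeRepro2
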